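import Summits.QuantumFields.YangMills.Theorems.BalabanUVNodesN27ReadOutAtOfKernelSlices
import Literature.MathematicalPhysics.QuantumFieldTheory.Balaban1983to89.Node00.U3OfKernels
import Literature.MathematicalPhysics.QuantumFieldTheory.Balaban1983to89.Node00.Record13CoPH

/-!
# BalabanUVNodes ∕ N27 = binder B5 — THE (D4) CLOSER AT node00-def-W1's KERNEL-KEYED U3 OBJECTS `Node00/U3OfKernels` (W1-19, p590183): `ReadOutAt` for def-B's β «on the
# merged term» at the generic objects `U3OfKernels.objects F ℰ ρ bV ℓ`, and ★ AT THE STAGE-13 DATUM OF RECORD `datumOfRecord₁₃ F N θ h` ∕ the v1.7 `datumOfRecord₁₃CoPH F N θ hP` on the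
# objects of record `U3OfKernels.objectsOfRecord₁₃ F N θ ℓ` — costing EXACTLY the letter signs `ℓ.Signs`, `0 < ℓ.κ`, `betaPrime510 4 1 ℓ.κ ≤ ℓ.cr` and ONE (5.10) clause
# `KernelDecayOfRecord₁₃ F N θ 0 1 ℓ.κ` (the `k`-uniform decay of the LIMITING (1.21) kernels of the merged term of record, [I] (5.10) p. 293 — located in print, NOT proved)

Cell `pub-ymgap` (HUMAN RULING D-0062 Track A; director-ym №197 ∕ HUMAN RULING D-0149), width seat `pub-ymgap-dag-n27-w1` (gen 0) on NODE n27 (B5 composite); INTENT-5 = the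
«CONSUMER ROAD (Summit side)» node00-def-W1 g28 named on landing W1-19 (bus l.25756; its token shapes, checked in def-W1's scratch, used VERBATIM): this seat's kernel-slice producer
`…N27ReadOutAtOfKernelSlices.readOutAt_u3OfRecord₁₃_of_kernelSlices` (p588537) at `dom := pt`, `bgB := bg`, `scale_pt`, `l1_le_d_pt`, with `RepresentsA∕B` BY NAME from W1-19's
`representsA∕B_objects` ∕ `representsA∕B_objectsOfRecord₁₃` (NO hypothesis — the β of record IS the (1.22) second moment of the stored kernels) and the run-B decay clause from
`kernelDecayB_of_kernelDecay` ∕ `kernelDecayB_objectsOfRecord₁₃`.  Filed `--kind proof --supports stmt-QuantumFields-20544 --as helper` (K3⁷ `SpineGivenEndpointR13SepCoPH`);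
COUNT-NEUTRAL.  [I] = [Balaban1987RG1].

WHAT IS KERNEL-CHECKED (theorems only; 0 `def`, 0 `sorry`).
* §1 `readOutAt_objects` — (D4) at the generic kernel objects for ANY datum whose β-function is `betaOfMerged (betaMerged F ℰ ρ bV) β0 θ.γ`, from `ℓ.Signs`, `0 < ℓ.κ`,
  `betaPrime510 4 1 ℓ.κ ≤ ℓ.cr`, `KernelDecay F ℰ ρ bV (Window θ.γ) 0 1 ℓ.κ`.
* §2 ★★ `readOutAt_objectsOfRecord₁₃` — (D4) AT THE STAGE-13 DATUM OF RECORD `datumOfRecord₁₃ F N θ h` on `objectsOfRecord₁₃ F N θ ℓ` (β-identification `rfl`), from `ℓ.Signs`,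
  `0 < ℓ.κ`, `betaPrime510 4 1 ℓ.κ ≤ ℓ.cr` and `KernelDecayOfRecord₁₃ F N θ 0 1 ℓ.κ`; ★★ `readOutAt_objectsOfRecord₁₃_coPH` — the same at NODE 00's v1.7 datum `datumOfRecord₁₃CoPH F N θ hP`
  (`θ : Stage13HParams`, objects and (5.10) clause read at `θ.toStage13Params`; `βfun_datumOfRecord₁₃CoPH` is `rfl`); `forall_readOutAt_objectsOfRecord₁₃_coPH` — the θ-keyed family
  form (any guard `G`, letter blocks `ℓ F θ`): the `hD4`-binder SHAPE of the N27 composers for a reading keyed on the kernel objects of record.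

HONEST FRAMING.  A REDUCTION, not a discharge: (D4) at the record ⟸ (5.10) for the limiting kernels of the merged term of record + letter inequalities; (5.10) is print's claim
(«yields», p. 293) derived there from the representation (4.37) — the tree's road to it is `B12Decay510.decay510_of_analytic_leaves` with its leaves as hypotheses (node N09∕N24
business), NOT walked here; the existence of the limit (1.21) is NOT asserted (`polLimit` is a total `limUnder`); the objects are INFINITE-VOLUME kernels (not W1's finite-volume (2.14)
functionals, so this does NOT fill leaf C∕F's `hD4` slot, which is keyed on `ReadingData.ofRecordAdm … .u3Objects`); NE4 ∕ NE5 ∕ NE9 NOT proved; N17 ∕ N27 NOT discharged; K3⁷ OPEN, NOT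
claimed; counts UNMOVED (typed 28∕28 · discharged 5∕27, A 5∕28); one finite four-torus programme at fixed `ε` — R4 closes the conditional rung `BalabanLadder.UV` only: NOT ℝ⁴, NOT
infinite volume, NOT OS, NOT a mass gap, NOT Clay.  No decl below carries a cite tag.
-/

namespace Summit.QuantumFields.YangMills.BalabanUVNodes.N27ReadOutAtU3OfKernels

open Literature.MathematicalPhysics.QuantumFieldTheory.Balaban1983to89
open Literature.MathematicalPhysics.QuantumFieldTheory.Balaban1983to89.T4Continuum
open Literature.MathematicalPhysics.QuantumFieldTheory.Balaban1983to89.T4OutputRate (Window)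
open Literature.MathematicalPhysics.QuantumFieldTheory.Balaban1983to89.B12Sec2to5 (betaPrime510)
open Literature.MathematicalPhysics.QuantumFieldTheory.Balaban1983to89.Node00.U3OfKernels (objects objectsOfRecord₁₃ pt bg scale_pt l1_le_d_pt representsA_objects
  representsB_objects representsA_objectsOfRecord₁₃ representsB_objectsOfRecord₁₃ KernelDecay KernelDecayOfRecord₁₃ kernelDecayB_of_kernelDecay kernelDecayOfRecord₁₃_iff
  kernelDecayB_objectsOfRecord₁₃)
open YMDAG.UVSplit
open Node00 (Stage13Params Stage13HParams U3Letters₁₁ datumOfRecord₁₃ datumOfRecord₁₃CoPH)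
open Summit.QuantumFields.YangMills.BalabanUVNodes.N27ReadOutAtOfKernelSlices (readOutAt_u3OfRecord₁₃_of_kernelSlices)

variable {F : T4Family} {N : ℕ} [NeZero N]

/-! ## §1 At the generic kernel objects, any datum carrying def-B's β on the merged term -/

section Generic

variable {𝔄 : Type*} [NormedRing 𝔄] [NormedAlgebra ℝ 𝔄] {V : Type*} [NormedAddCommGroup V] [NormedSpace ℝ V] {ι : Type*} [Fintype ι]

/-- **(D4) AT THE KERNEL-KEYED OBJECTS `objects F ℰ ρ bV ℓ`** for ANY datum `D` whose β-function IS def-B's `betaOfMerged (betaMerged F ℰ ρ bV) β0 θ.γ` (displayed face `hβ`):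
`ReadOutAt D (u3OfRecord₁₃ θ (objects F ℰ ρ bV ℓ) k)` from the letter signs, `0 < ℓ.κ`, `betaPrime510 4 1 ℓ.κ ≤ ℓ.cr` and the ONE (5.10) clause `KernelDecay F ℰ ρ bV (Window θ.γ) 0 1 ℓ.κ`
(run B's clause follows on the window).  A reduction; (5.10) NOT proved. [bookkeeping] -/
theorem readOutAt_objects (ℰ : Node00.TermFamily1 F 𝔄) (ρ : V →L[ℝ] 𝔄) (bV : Module.Basis ι ℝ V) (β0 : ℕ → ℝ) (ℓ : U3Letters₁₁) (hs : ℓ.Signs) (hκ : 0 < ℓ.κ)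
    (hcr : betaPrime510 4 1 ℓ.κ ≤ ℓ.cr) (θ : Stage13Params F N) (k : ℕ) (D : Datum F N) (hβ : D.βfun = Node00.betaOfMerged (Node00.betaMerged F ℰ ρ bV) β0 θ.γ)
    (hdec : KernelDecay F ℰ ρ bV (Window θ.γ) 0 1 ℓ.κ) :
    ReadOutAt D (u3OfRecord₁₃ θ (objects F ℰ ρ bV ℓ) k) := by
  have hA := representsA_objects F ℰ ρ bV ℓ β0 θ.γ k
  have hB := representsB_objects F ℰ ρ bV ℓ β0 θ.γ k
  rw [← hβ] at hA hB
  exact readOutAt_u3OfRecord₁₃_of_kernelSlices θ (objects F ℰ ρ bV ℓ) hs k D 0 1 pt bg scale_pt l1_le_d_pt hκ hcr hA hB hdec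
    (kernelDecayB_of_kernelDecay F ℰ ρ bV hdec)

end Generic

/-! ## §2 At the Stage-13 datum of record (def-T's `datumOfRecord₁₃`, NODE 00's v1.7 `datumOfRecord₁₃CoPH`) on the kernel objects of record -/

/-- ★★ **(D4) AT THE STAGE-13 DATUM OF RECORD ON THE KERNEL OBJECTS OF RECORD**: `ReadOutAt (datumOfRecord₁₃ F N θ h) (u3OfRecord₁₃ θ (objectsOfRecord₁₃ F N θ ℓ) k)` for every run
length `k`, from `ℓ.Signs`, `0 < ℓ.κ`, `betaPrime510 4 1 ℓ.κ ≤ ℓ.cr` and ONE (5.10) clause `KernelDecayOfRecord₁₃ F N θ 0 1 ℓ.κ` — `RepresentsA∕B` for `betaOfRecord₁₃ F N θ` hold BY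
CONSTRUCTION (W1-19 `representsA∕B_objectsOfRecord₁₃`), `ReadBoundedOn∕ReadCovariantOn` by (5.10) ⇒ (5.42).  A reduction of (D4) to print's (5.10); NOT a discharge. [bookkeeping] -/
theorem readOutAt_objectsOfRecord₁₃ (θ : Stage13Params F N) (h : θ.Provisos₁₃ F N) (ℓ : U3Letters₁₁) (hs : ℓ.Signs) (hκ : 0 < ℓ.κ)
    (hcr : betaPrime510 4 1 ℓ.κ ≤ ℓ.cr) (k : ℕ) (hdec : KernelDecayOfRecord₁₃ F N θ 0 1 ℓ.κ) :
    ReadOutAt (datumOfRecord₁₃ F N θ h) (u3OfRecord₁₃ θ (objectsOfRecord₁₃ F N θ ℓ) k) :=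
  readOutAt_u3OfRecord₁₃_of_kernelSlices θ (objectsOfRecord₁₃ F N θ ℓ) hs k (datumOfRecord₁₃ F N θ h) 0 1 pt bg scale_pt l1_le_d_pt hκ hcr
    (representsA_objectsOfRecord₁₃ F N θ ℓ k) (representsB_objectsOfRecord₁₃ F N θ ℓ k) ((kernelDecayOfRecord₁₃_iff F N θ ℓ k 0 1 ℓ.κ).1 hdec)
    (kernelDecayB_objectsOfRecord₁₃ F N θ ℓ k hdec)

/-- ★★ **(D4) AT NODE 00's v1.7 STAGE-13 DATUM `datumOfRecord₁₃CoPH F N θ hP`** (`θ : Stage13HParams`; objects, window and (5.10) clause read at `θ.toStage13Params`; the β-face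
`(datumOfRecord₁₃CoPH F N θ hP).βfun = betaOfRecord₁₃ F N θ.toStage13Params` is `Node00.βfun_datumOfRecord₁₃CoPH`, `rfl`).  Same four inputs; NOT a discharge. [bookkeeping] -/
theorem readOutAt_objectsOfRecord₁₃_coPH (θ : Stage13HParams F N) (hP : θ.Provisos₁₃CoPH F N) (ℓ : U3Letters₁₁) (hs : ℓ.Signs) (hκ : 0 < ℓ.κ)
    (hcr : betaPrime510 4 1 ℓ.κ ≤ ℓ.cr) (k : ℕ) (hdec : KernelDecayOfRecord₁₃ F N θ.toStage13Params 0 1 ℓ.κ) :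
    ReadOutAt (datumOfRecord₁₃CoPH F N θ hP) (u3OfRecord₁₃ θ.toStage13Params (objectsOfRecord₁₃ F N θ.toStage13Params ℓ) k) := by
  have hA := representsA_objectsOfRecord₁₃ F N θ.toStage13Params ℓ k
  have hB := representsB_objectsOfRecord₁₃ F N θ.toStage13Params ℓ k
  rw [← Node00.βfun_datumOfRecord₁₃CoPH F N θ hP] at hA hB
  exact readOutAt_u3OfRecord₁₃_of_kernelSlices θ.toStage13Params (objectsOfRecord₁₃ F N θ.toStage13Params ℓ) hs k (datumOfRecord₁₃CoPH F N θ hP) 0 1 pt bg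
    scale_pt l1_le_d_pt hκ hcr hA hB ((kernelDecayOfRecord₁₃_iff F N θ.toStage13Params ℓ k 0 1 ℓ.κ).1 hdec)
    (kernelDecayB_objectsOfRecord₁₃ F N θ.toStage13Params ℓ k hdec)

/-- **THE θ-KEYED FAMILY FORM AT THE v1.7 RECORD** (any guard `G`, letter blocks `ℓ F θ` read at the tuple): the `hD4`-binder SHAPE of the N27 composers for a U3 reading keyed on the
kernel objects of record — from per-tuple signs, `0 < κ`, `betaPrime510 4 1 κ ≤ cr` and the (5.10) clause of record.  (Leaf C∕F's own `hD4` is keyed on W1's finite-volume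
`ReadingData.ofRecordAdm … .u3Objects` and is NOT filled by this.)  NOT a discharge. [bookkeeping] -/
theorem forall_readOutAt_objectsOfRecord₁₃_coPH (G : ∀ {F : T4Family}, Stage13HParams F N → Prop) (ℓ : (F : T4Family) → Stage13HParams F N → U3Letters₁₁)
    (hs : ∀ (F : T4Family) (θ : Stage13HParams F N), θ.Provisos₁₃CoPH F N → G θ → θ.Admissible F N → (ℓ F θ).Signs)
    (hκ : ∀ (F : T4Family) (θ : Stage13HParams F N), θ.Provisos₁₃CoPH F N → G θ → θ.Admissible F N → 0 < (ℓ F θ).κ)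
    (hcr : ∀ (F : T4Family) (θ : Stage13HParams F N), θ.Provisos₁₃CoPH F N → G θ → θ.Admissible F N → betaPrime510 4 1 (ℓ F θ).κ ≤ (ℓ F θ).cr)
    (hdec : ∀ (F : T4Family) (θ : Stage13HParams F N), θ.Provisos₁₃CoPH F N → G θ → θ.Admissible F N → KernelDecayOfRecord₁₃ F N θ.toStage13Params 0 1 (ℓ F θ).κ) :
    ∀ (F : T4Family) (θ : Stage13HParams F N) (hP : θ.Provisos₁₃CoPH F N), G θ → θ.Admissible F N → ∀ k : ℕ,
      ReadOutAt (datumOfRecord₁₃CoPH F N θ hP) (u3OfRecord₁₃ θ.toStage13Params (objectsOfRecord₁₃ F N θ.toStage13Params (ℓ F θ)) k) :=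
  fun F θ hP hG hθ k =>
    readOutAt_objectsOfRecord₁₃_coPH θ hP (ℓ F θ) (hs F θ hP hG hθ) (hκ F θ hP hG hθ) (hcr F θ hP hG hθ) k (hdec F θ hP hG hθ)

end Summit.QuantumFields.YangMills.BalabanUVNodes.N27ReadOutAtU3OfKernels
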